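import Summits.QuantumFields.BalabanUV.T4Continuum.Spine.NE2.OneStepLoopLadder
import Summits.QuantumFields.BalabanUV.T4Continuum.Support.CovariantLineSlotExp
import Literature.MathematicalPhysics.QuantumFieldTheory.Balaban1983to89.B7Prop2Explicit

/-!
# T⁴ programme, spine node NE2 (U1a) — R14 W3c, file 2: THE LOOP `Γ_{c,x} ∪ (−c)` OF [B7] (114), ITS NON-ABELIAN STOKES BOUND, AND THE LOOP LOGARITHMS
# `Y_x = (1/i) log V₀(Γ_{c,x} ∪ (−c))`, `Y = Σ_x L^{−d} Y_x` WITH `|Y_x|, |Y| ≤ 2dL²·(plaquette letter)` (cell `pub-balaban-gaps`, seat ne2 gen 6)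

[B7] p. 34 (114): «`A_x = (1/i) log(R_{0,c₋}V₁)(Γ_{c,x} ∪ (−c))`, `Y_x = (1/i) log V₀(Γ_{c,x} ∪ (−c))`»; p. 35: «Denoting `Σ_{x∈B(c₋)} L^{−d} Y_x = Y` …»; p. 36: «In all the
estimates above, we have assumed that `α₀`, `α₁` are sufficiently small so that the formulas and inequalities proved in Sect. A hold, and that `|Y_x| = O(L²α₀)` are small.»; (115) reads
the loop as `Γ_{c₋,x} ∪ [x, x′] ∪ (−Γ_{c₊,x′}) ∪ (−c)` — the comb from the corner of `B(c₋)` to `x`, the line of `L` bonds from `x` in direction `μ`, back along the comb of `B(c₊)`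
(the translate by `L e_μ`), back along the coarse bond `c` (`L` fine bonds); p. 25 derives `|V₀(Γ_{c,x}) − 1| < |Γ_{c,x}|dLα₀ = O(1)L²α₀` from (44) `|V(∂p) − 1| < α₀` by Prop. 1's
ladder, then takes the logarithm (21)/(26).  THIS FILE makes that quantitative on the tree's one-step carriers, for unitary transporter DATA `V` (slot convention of
`CovariantBlockAveraging.transport`), on top of the ladder of `OneStepLoopLadder`:
 * §2 THE LOOP **`loopHol`** `= T(Γ_{z,x} ∪ [x,x′])·(T(c)·T(Γ_{z⁺,x′}))ᴴ`, the two currencies of the plaquette letter (**`norm_plaq_comm_eq`**: commutator form `=` `‖V(∂p) − 1‖` for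
   unitary data — (44)/(109)), and **`norm_loopHol_sub_one_le`**: `‖V₀(Γ_{c,x} ∪ (−c)) − 1‖ ≤ (Σ_ν r_ν)·L·p` (print p. 25: `O(1)L²α₀`; the constant is the comb length `Σ_ν r_ν ≤ d(L−1)`
   times the sweep length `L`);
 * §3 THE LOOP LOGARITHMS **`Yx`** `= (−i)·log(loopHol)` ((114); `MatrixLog.mlog` = (21)) and the block mean **`Ybar`** (p. 35), with `e^{iY_x} = V₀(Γ_{c,x} ∪ (−c))` (`exp_I_smul_Yx`),
   (26) `‖Y_x‖ ≤ 2‖loop − 1‖`, hermiticity for unitary data (`Yx_isHermitian`, `Ybar_isHermitian` — (22)–(23) via `B7Prop2Explicit.star_mlog_eq_neg`), membership of `Ybar` in any real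
   submodule containing the `Y_x` (`Ybar_mem`);
 * §4 **`norm_Yx_le_of_plaquettes`** / **`norm_Ybar_le_of_plaquettes`**: `‖Y_x‖, ‖Y‖ ≤ 2·d·L²·p` and hermitian whenever `d·L²·p ≤ 1/4` — p. 36's «|Y_x| = O(L²α₀)» with the constant `2d`.
These are the loop-logarithm letters `y` consumed by `OneStepRemainderAdjoint.norm_coeffG₁/₂/₃_le` (‖G_i‖ ≤ 32y for y ≤ 1/8): the (126) coefficient letter `γ = O(L²α₀)` of
`OneStepRemainder`'s data then reads `γ = 64·d·L²·p` from the plaquette letter `p` of the background at that step (successor file: the `RemCoeff` supplier).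
HONEST FRAMING (T4-DAG p. 1).  [folklore] group/normed-ring bookkeeping about the tree's MODEL transporters on a finite torus; `V` is DATA asserted by nobody; the plaquette letter is a
HYPOTHESIS SHAPE ((44)/(109) locate it, nothing printed is asserted); NOT an instance of Bałaban's minimiser or of (3.35); NOT NE2, NOT [B9] (3.16)/(3.26) as printed; **NE2 (U1a) NOT
PROVED**; spine PROVED 0/9 unchanged; NOT continuum YM / infinite volume / mass gap / Clay.  HONEST DEPENDENCY: continuum YM on T⁴ ⇐ BetaPertH ∧ nine spine estimates (0/9 proved);
BetaPertH ⇐ (D1) ∧ (D4) ∧ CAP+tail; G-an2-4 gates asym, D1 and NE2/3/4.  No `sorry`.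
-/

noncomputable section

open scoped BigOperators ComplexConjugate Matrix Matrix.Norms.L2Operator

namespace Summit.QuantumFields.BalabanUV.T4Continuum.NE2.OneStepLoopHolonomy

open Literature.MathematicalPhysics.QuantumFieldTheory.Balaban1983to89.B5Prop11Plancherel (Tor fine unitVec)
open Literature.MathematicalPhysics.QuantumFieldTheory.Balaban1983to89.B5Block118 (tstep tstep_zero tstep_succ)
open Literature.MathematicalPhysics.QuantumFieldTheory.Balaban1983to89.MatrixLog (mlog norm_mlog_le_two_mul exp_mlog)
open Literature.MathematicalPhysics.QuantumFieldTheory.Balaban1983to89.B7Prop2Explicit (star_mlog_eq_neg)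
open Summit.QuantumFields.BalabanUV.T4Continuum.CovariantBlockAveraging (transport transport_append leg length_leg)
open Summit.QuantumFields.BalabanUV.T4Continuum.CovariantLineSlotExp (norm_le_one_of_mem_unitary)
open Summit.QuantumFields.BalabanUV.T4Continuum.NE2.CovariantTableBalaban (contourFrom)
open Summit.QuantumFields.BalabanUV.T4Continuum.NE2.OneStepLoopLadder

variable {d : ℕ} (N : ℕ) [NeZero N] (M : Fin d → ℕ) [hM : ∀ μ, NeZero (M μ)] {m : Type*} [Fintype m] [DecidableEq m]

/-! ## §2 The loop `Γ_{c,x} ∪ (−c)` and its Stokes bound -/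

section Loop

variable (V : Fin d → (Tor (fine N M) × Fin d → Matrix m m ℂ)) (μ : Fin d) (ℓ : ℕ)

/-- **THE LOOP HOLONOMY `V₀(Γ_{c,x} ∪ (−c))`** of (114) on the one-step carriers: from the corner `z` of `B(c₋)` along the comb to `x = z + r`, `ℓ` bonds along `μ` to `x′`, back along the
comb of `B(c₊)` (corner `z⁺ = z + ℓe_μ`) and back along `c` — `T(Γ_{z,x} ∪ [x,x′])·(T(c)·T(Γ_{z⁺,x′}))ᴴ` (inverse = conjugate transpose for unitary data; prefix-transport reading (ii) of
`ne/NE2.md` §13 (b)). [cite: Balaban1985Averaging, (114) p.34, (115) p.34 (shape)] [folklore] -/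
def loopHol (z : Tor (fine N M)) (r : Fin d → ℕ) : Matrix m m ℂ :=
  transport (fine N M) V μ (contourFrom M N z r μ ℓ)
    * (transport (fine N M) V μ (leg N M μ z ℓ) * transport (fine N M) V μ (contourFrom M N (z + tstep (fine N M) μ ℓ) r μ 0))ᴴ

variable {V}

omit [NeZero N] hM in
/-- transports of unitary data are unitary. [folklore] -/
theorem transport_mem_unitaryGroup (hVu : ∀ ν b, V ν b ∈ Matrix.unitaryGroup m ℂ) (P : List (Tor (fine N M) × Fin d)) :
    transport (fine N M) V μ P ∈ Matrix.unitaryGroup m ℂ := by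
  rw [transport]
  refine Submonoid.list_prod_mem _ fun X hX => ?_
  obtain ⟨b, _, rfl⟩ := List.mem_map.mp hX
  exact hVu _ _

omit [NeZero N] hM in
/-- unitary data are contractive. [folklore] -/
theorem norm_le_one_of_unitary (hVu : ∀ ν b, V ν b ∈ Matrix.unitaryGroup m ℂ) (ν : Fin d) (b : Tor (fine N M) × Fin d) : ‖V ν b‖ ≤ 1 :=
  norm_le_one_of_mem_unitary (hVu ν b)

omit [NeZero N] hM in
/-- **THE TWO CURRENCIES OF THE PLAQUETTE LETTER**: for unitary data the commutator form `V_ν(x)V_μ(x+e_ν) − V_μ(x)V_ν(x+e_μ)` has the norm of `V(∂p) − 1`,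
`V(∂p) = V_ν(x)V_μ(x+e_ν)V_ν(x+e_μ)ᴴV_μ(x)ᴴ` — print's (44)/(109) `|V₀(∂p) − 1| < α₀`. [cite: Balaban1985Averaging, (44) p.24, (109) p.34 (shape)] [folklore] -/
theorem norm_plaq_comm_eq (hVu : ∀ ν b, V ν b ∈ Matrix.unitaryGroup m ℂ) (x : Tor (fine N M)) (ν : Fin d) :
    ‖V ν (x, μ) * V μ (x + unitVec (fine N M) ν, μ) - V μ (x, μ) * V ν (x + unitVec (fine N M) μ, μ)‖
      = ‖V ν (x, μ) * V μ (x + unitVec (fine N M) ν, μ) * (V ν (x + unitVec (fine N M) μ, μ))ᴴ * (V μ (x, μ))ᴴ - 1‖ := by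
  set A := V ν (x, μ) * V μ (x + unitVec (fine N M) ν, μ)
  set B := V μ (x, μ) * V ν (x + unitVec (fine N M) μ, μ) with hB
  have hBu : B ∈ Matrix.unitaryGroup m ℂ := Submonoid.mul_mem _ (hVu _ _) (hVu _ _)
  have hBB : B * star B = 1 := Matrix.mem_unitaryGroup_iff.mp hBu
  have e : A * (V ν (x + unitVec (fine N M) μ, μ))ᴴ * (V μ (x, μ))ᴴ - 1 = (A - B) * star B := by
    rw [sub_mul, hBB, hB, Matrix.star_eq_conjTranspose, Matrix.conjTranspose_mul, Matrix.mul_assoc]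
  rw [e, CStarRing.norm_mul_mem_unitary _ (Unitary.star_mem hBu)]

omit hM in
/-- **STOKES FOR THE THIN LOOP OF (114)**: for unitary data with the plaquette letter `p` in the `(ν, μ)`-planes, `‖V₀(Γ_{c,x} ∪ (−c)) − 1‖ ≤ (Σ_ν r_ν)·ℓ·p` (the comb from the corner `z` to
`x = z + r`, swept by the `ℓ` steps of the line). [cite: Balaban1985Averaging, p.25 (|V₀(Γ_{c,x}) − 1| < |Γ_{c,x}|dLα₀ = O(1)L²α₀, shape)] [folklore] -/
theorem norm_loopHol_sub_one_le [Nonempty m] (hVu : ∀ ν b, V ν b ∈ Matrix.unitaryGroup m ℂ) {p : ℝ} (hp0 : 0 ≤ p)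
    (hp : ∀ (x : Tor (fine N M)) (ν : Fin d),
      ‖V ν (x, μ) * V μ (x + unitVec (fine N M) ν, μ) - V μ (x, μ) * V ν (x + unitVec (fine N M) μ, μ)‖ ≤ p)
    (z : Tor (fine N M)) (r : Fin d → ℕ) : ‖loopHol N M V μ ℓ z r - 1‖ ≤ (∑ ν, (r ν : ℝ)) * ℓ * p := by
  have hV : ∀ ν b, ‖V ν b‖ ≤ 1 := norm_le_one_of_unitary N M hVu
  have hlad := lad_comb_le N M μ ℓ hV hp0 hp z r
  rw [lad, shiftBonds_comb] at hlad
  rw [loopHol, contourFrom_eq, contourFrom_eq, transport_append, transport_append, leg_zero, transport_nil, Matrix.mul_one]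
  set A := transport (fine N M) V μ (comb N M z r) * transport (fine N M) V μ (leg N M μ (z + rvec N M r) ℓ)
  set B := transport (fine N M) V μ (leg N M μ z ℓ) * transport (fine N M) V μ (comb N M (z + tstep (fine N M) μ ℓ) r) with hB
  have hBu : B ∈ Matrix.unitaryGroup m ℂ := Submonoid.mul_mem _ (transport_mem_unitaryGroup N M μ hVu _) (transport_mem_unitaryGroup N M μ hVu _)
  have hBB : B * Bᴴ = 1 := by rw [← Matrix.star_eq_conjTranspose]; exact Matrix.mem_unitaryGroup_iff.mp hBu
  have e : A * Bᴴ - 1 = (A - B) * Bᴴ := by rw [sub_mul, hBB]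
  rw [e]
  refine (Matrix.l2_opNorm_mul _ _).trans ?_
  have hBn : ‖Bᴴ‖ ≤ 1 := by rw [Matrix.l2_opNorm_conjTranspose]; exact norm_le_one_of_mem_unitary hBu
  calc ‖A - B‖ * ‖Bᴴ‖ ≤ (∑ ν, (r ν : ℝ)) * ℓ * p * 1 := mul_le_mul hlad hBn (norm_nonneg _) (by positivity)
    _ = _ := mul_one _

omit hM in
/-- the loop holonomy of unitary data is unitary. [folklore] -/
theorem loopHol_mem_unitaryGroup (hVu : ∀ ν b, V ν b ∈ Matrix.unitaryGroup m ℂ) (z : Tor (fine N M)) (r : Fin d → ℕ) :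
    loopHol N M V μ ℓ z r ∈ Matrix.unitaryGroup m ℂ := by
  refine Submonoid.mul_mem _ (transport_mem_unitaryGroup N M μ hVu _) ?_
  rw [← Matrix.star_eq_conjTranspose]
  exact Unitary.star_mem (Submonoid.mul_mem _ (transport_mem_unitaryGroup N M μ hVu _) (transport_mem_unitaryGroup N M μ hVu _))

end Loop

/-! ## §3 The loop logarithms `Y_x` (114) and their block mean `Y` (p. 35) -/

section Logs

variable (V : Fin d → (Tor (fine N M) × Fin d → Matrix m m ℂ)) (μ : Fin d) (L : ℕ)

/-- **`Y_x = (1/i) log V₀(Γ_{c,x} ∪ (−c))`** (114), with the logarithmic series (21) (`MatrixLog.mlog`); the line of the loop has the block side `L` as its length.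
[cite: Balaban1985Averaging, (114) p.34] [folklore] -/
def Yx (z : Tor (fine N M)) (r : Fin d → ℕ) : Matrix m m ℂ := (-Complex.I) • mlog (loopHol N M V μ L z r)

/-- **`Y = Σ_{x∈B(c₋)} L^{−d} Y_x`** (p. 35), the block mean of the loop logarithms over the digits `r ∈ [0,L)^d`. [cite: Balaban1985Averaging, p.35] [folklore] -/
def Ybar (z : Tor (fine N M)) : Matrix m m ℂ := ∑ r : Fin d → Fin L, (((L : ℝ) ^ d)⁻¹) • Yx N M V μ L z (fun ν => (r ν : ℕ))

variable {V}

omit hM in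
/-- (26): `‖Y_x‖ ≤ 2‖V₀(Γ_{c,x} ∪ (−c)) − 1‖` once the loop is within `1/2` of `1`. [cite: Balaban1985Averaging, (26) p.22] [folklore] -/
theorem norm_Yx_le {z : Tor (fine N M)} {r : Fin d → ℕ} {δ : ℝ} (h : ‖loopHol N M V μ L z r - 1‖ ≤ δ) (hδ : δ ≤ 1 / 2) : ‖Yx N M V μ L z r‖ ≤ 2 * δ := by
  rw [Yx, norm_smul, norm_neg, Complex.norm_I, one_mul]
  exact (norm_mlog_le_two_mul (h.trans hδ)).trans (by linarith)

omit hM in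
/-- `e^{iY_x} = V₀(Γ_{c,x} ∪ (−c))` (the logarithm inverts the exponential, p. 21) once the loop is within `1` of `1`. [cite: Balaban1985Averaging, (21) p.21] [folklore] -/
theorem exp_I_smul_Yx {z : Tor (fine N M)} {r : Fin d → ℕ} (h : ‖loopHol N M V μ L z r - 1‖ < 1) :
    NormedSpace.exp (Complex.I • Yx N M V μ L z r) = loopHol N M V μ L z r := by
  rw [Yx, smul_smul, mul_neg, Complex.I_mul_I, neg_neg, one_smul]
  exact exp_mlog h

omit hM in
/-- **`Y_x` IS HERMITIAN** for unitary data once the loop is within `1/4` of `1` ((22)–(23): the logarithm of a unitary is `i`·hermitian). [cite: Balaban1985Averaging, (22)–(23) p.21] [folklore] -/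
theorem Yx_isHermitian (hVu : ∀ ν b, V ν b ∈ Matrix.unitaryGroup m ℂ) {z : Tor (fine N M)} {r : Fin d → ℕ} (h : ‖loopHol N M V μ L z r - 1‖ ≤ 1 / 4) :
    (Yx N M V μ L z r).IsHermitian := by
  letI : CStarAlgebra (Matrix m m ℂ) := {}
  have hs : star (mlog (loopHol N M V μ L z r)) = -mlog (loopHol N M V μ L z r) := star_mlog_eq_neg (loopHol_mem_unitaryGroup N M μ L hVu z r) h
  unfold Matrix.IsHermitian
  rw [Yx, Matrix.conjTranspose_smul, ← Matrix.star_eq_conjTranspose, hs, star_neg, Complex.star_def, Complex.conj_I, neg_neg, smul_neg,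
    neg_smul]

omit hM in
/-- the block mean inherits the letter: `‖Y‖ ≤ y` if every `‖Y_x‖ ≤ y`. [folklore] -/
theorem norm_Ybar_le [NeZero L] {z : Tor (fine N M)} {y : ℝ} (h : ∀ r : Fin d → Fin L, ‖Yx N M V μ L z (fun ν => (r ν : ℕ))‖ ≤ y) : ‖Ybar N M V μ L z‖ ≤ y := by
  have hL : (0 : ℝ) < (L : ℝ) ^ d := pow_pos (by exact_mod_cast Nat.pos_of_ne_zero (NeZero.ne L)) d
  rw [Ybar]
  refine (norm_sum_le _ _).trans ?_
  calc ∑ r : Fin d → Fin L, ‖(((L : ℝ) ^ d)⁻¹) • Yx N M V μ L z (fun ν => (r ν : ℕ))‖ ≤ ∑ _r : Fin d → Fin L, ((L : ℝ) ^ d)⁻¹ * y :=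
        Finset.sum_le_sum fun r _ => by rw [norm_smul, norm_inv, norm_pow, Real.norm_natCast]; exact mul_le_mul_of_nonneg_left (h r) (by positivity)
    _ = y := by
        rw [Finset.sum_const, Finset.card_univ, Fintype.card_fun, Fintype.card_fin, Fintype.card_fin, nsmul_eq_mul]
        push_cast
        rw [← mul_assoc, mul_inv_cancel₀ hL.ne', one_mul]

omit hM in
/-- the block mean is hermitian if every `Y_x` is. [folklore] -/
theorem Ybar_isHermitian {z : Tor (fine N M)} (h : ∀ r : Fin d → Fin L, (Yx N M V μ L z (fun ν => (r ν : ℕ))).IsHermitian) : (Ybar N M V μ L z).IsHermitian := by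
  unfold Matrix.IsHermitian
  rw [Ybar, Matrix.conjTranspose_sum]
  refine Finset.sum_congr rfl fun r _ => ?_
  rw [Matrix.conjTranspose_smul, star_trivial, (h r).eq]

omit hM in
/-- the block mean lies in any real submodule containing the `Y_x` (e.g. the hermitian, or the traceless hermitian, matrices). [folklore] -/
theorem Ybar_mem (P : Submodule ℝ (Matrix m m ℂ)) {z : Tor (fine N M)} (h : ∀ r : Fin d → Fin L, Yx N M V μ L z (fun ν => (r ν : ℕ)) ∈ P) : Ybar N M V μ L z ∈ P :=
  P.sum_mem fun r _ => P.smul_mem _ (h r)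

end Logs

/-! ## §4 `|Y_x|, |Y| = O(L²α₀)` from the plaquette letter -/

section Letters

variable {V : Fin d → (Tor (fine N M) × Fin d → Matrix m m ℂ)} (μ : Fin d) (L : ℕ)

omit [NeZero N] hM in
/-- digits are `< L`, so the comb has `Σ_ν r_ν ≤ d·L` bonds and `(Σ_ν r_ν)·L·p ≤ d·L²·p`. [folklore] -/
theorem sum_digits_mul_le (r : Fin d → Fin L) {p : ℝ} (hp0 : 0 ≤ p) : (∑ ν, ((r ν : ℕ) : ℝ)) * L * p ≤ d * (L : ℝ) ^ 2 * p := by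
  have h : (∑ ν, ((r ν : ℕ) : ℝ)) ≤ d * (L : ℝ) := by
    calc (∑ ν, ((r ν : ℕ) : ℝ)) ≤ ∑ _ν : Fin d, (L : ℝ) := Finset.sum_le_sum fun ν _ => by exact_mod_cast (r ν).2.le
      _ = d * (L : ℝ) := by rw [Finset.sum_const, Finset.card_univ, Fintype.card_fin, nsmul_eq_mul]
  have hL : (0 : ℝ) ≤ L := Nat.cast_nonneg _
  calc (∑ ν, ((r ν : ℕ) : ℝ)) * L * p = (∑ ν, ((r ν : ℕ) : ℝ)) * (L * p) := by ring
    _ ≤ (d * (L : ℝ)) * (L * p) := mul_le_mul_of_nonneg_right h (mul_nonneg hL hp0)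
    _ = d * (L : ℝ) ^ 2 * p := by ring

omit hM in
/-- the loop is within `d·L²·p` of `1`. [folklore] -/
theorem norm_loopHol_sub_one_le_of_digits [Nonempty m] (hVu : ∀ ν b, V ν b ∈ Matrix.unitaryGroup m ℂ) {p : ℝ} (hp0 : 0 ≤ p)
    (hp : ∀ (x : Tor (fine N M)) (ν : Fin d),
      ‖V ν (x, μ) * V μ (x + unitVec (fine N M) ν, μ) - V μ (x, μ) * V ν (x + unitVec (fine N M) μ, μ)‖ ≤ p)
    (z : Tor (fine N M)) (r : Fin d → Fin L) : ‖loopHol N M V μ L z (fun ν => (r ν : ℕ)) - 1‖ ≤ d * (L : ℝ) ^ 2 * p :=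
  (norm_loopHol_sub_one_le N M μ L hVu hp0 hp z _).trans (sum_digits_mul_le L r hp0)

omit hM in
/-- **`|Y_x| = O(L²α₀)`** (p. 36), QUANTITATIVE: for unitary data with plaquette letter `p` and `d·L²·p ≤ 1/4`, `‖Y_x‖ ≤ 2·d·L²·p` and `Y_x` is hermitian.
[cite: Balaban1985Averaging, p.36 (|Y_x| = O(L²α₀)), p.25 (shape)] [folklore] -/
theorem norm_Yx_le_of_plaquettes [Nonempty m] (hVu : ∀ ν b, V ν b ∈ Matrix.unitaryGroup m ℂ) {p : ℝ} (hp0 : 0 ≤ p)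
    (hp : ∀ (x : Tor (fine N M)) (ν : Fin d),
      ‖V ν (x, μ) * V μ (x + unitVec (fine N M) ν, μ) - V μ (x, μ) * V ν (x + unitVec (fine N M) μ, μ)‖ ≤ p)
    (hsmall : d * (L : ℝ) ^ 2 * p ≤ 1 / 4) (z : Tor (fine N M)) (r : Fin d → Fin L) :
    ‖Yx N M V μ L z (fun ν => (r ν : ℕ))‖ ≤ 2 * (d * (L : ℝ) ^ 2 * p) ∧ (Yx N M V μ L z (fun ν => (r ν : ℕ))).IsHermitian :=
  have h := norm_loopHol_sub_one_le_of_digits N M μ L hVu hp0 hp z r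
  ⟨norm_Yx_le N M μ L h (by linarith), Yx_isHermitian N M μ L hVu (h.trans hsmall)⟩

omit hM in
/-- **`|Y| = O(L²α₀)`**: the block mean obeys the same letter and is hermitian. [cite: Balaban1985Averaging, p.36 (shape)] [folklore] -/
theorem norm_Ybar_le_of_plaquettes [Nonempty m] [NeZero L] (hVu : ∀ ν b, V ν b ∈ Matrix.unitaryGroup m ℂ) {p : ℝ} (hp0 : 0 ≤ p)
    (hp : ∀ (x : Tor (fine N M)) (ν : Fin d),
      ‖V ν (x, μ) * V μ (x + unitVec (fine N M) ν, μ) - V μ (x, μ) * V ν (x + unitVec (fine N M) μ, μ)‖ ≤ p)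
    (hsmall : d * (L : ℝ) ^ 2 * p ≤ 1 / 4) (z : Tor (fine N M)) :
    ‖Ybar N M V μ L z‖ ≤ 2 * (d * (L : ℝ) ^ 2 * p) ∧ (Ybar N M V μ L z).IsHermitian :=
  ⟨norm_Ybar_le N M μ L fun r => (norm_Yx_le_of_plaquettes N M μ L hVu hp0 hp hsmall z r).1,
    Ybar_isHermitian N M μ L fun r => (norm_Yx_le_of_plaquettes N M μ L hVu hp0 hp hsmall z r).2⟩

end Letters

end Summit.QuantumFields.BalabanUV.T4Continuum.NE2.OneStepLoopHolonomy

end
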